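import Summits.ResolutionOfSingularities.ResolutionOfSingularities.Theorems.FrameStep2

/-!
# KFrameRing — the frame ring `B(θ)` is local with maximal ideal the origin ideal (piece P1 of the tower dictionary)

0-weight TOOL toward `TightDefectClasses.TowerDictionary` (decomp-res lens-5, g39; plan `NEXT-g40.md` §6.11, piece P1).
For an injective frame `θ : K[Z,u] → L`, the subring `B(θ) = FrameStep.frameRing θ hθ = { θ a / θ s : s(0) ≠ 0 }` is LOCAL (`isLocalRing_frameRing`), its units are the
fractions with `a(0) ≠ 0` (`isUnit_mk_div_iff`), its maximal ideal read in `L` is `{ θ a / θ s : a(0) = 0, s(0) ≠ 0 }` (`mem_maxSet_frameRing_iff`), and its maximal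
ideal IS the origin ideal `(θ Z, θ u)` (`originIdeal_eq_maximalIdeal`) — so the `cert` slot `PointBlowupCert (frameRing θ hθ) B' (originIdeal θ hθ)` of `frame_step` is a
certificate along the maximal ideal, as the transported certificates of `KCert` are.  All PROVED, 0 sorry.  [cite: ZariskiSamuel1958, Ch. IV §11]; [cite: Matsumura1987, §4].
-/

noncomputable section

set_option linter.dupNamespace false

namespace Summit.ResolutionOfSingularities.ResolutionOfSingularities.Theorems.KFrameRing

open MvPolynomial IsLocalRing
open Summit.ResolutionOfSingularities.ResolutionOfSingularities.Theorems.FrameStep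

variable {σ : Type} [Fintype σ] [DecidableEq σ] {K : Type} [Field K] {L : Type} [Field L] [Algebra K L]
  (θ : MvPolynomial (Option σ) K →ₐ[K] L) (hθ : Function.Injective θ)

omit [Fintype σ] [DecidableEq σ] in
include hθ in
/-- `θ s ≠ 0` for `s ∉ 𝔫`. -/
theorem map_ne_zero_of_not_mem {s : MvPolynomial (Option σ) K} (hs : s ∉ idealOfVars (Option σ) K) : θ s ≠ 0 :=
  (isUnit_map_of_not_mem θ hθ hs).ne_zero

omit [Fintype σ] [DecidableEq σ] in
/-- **Units of `B(θ)`**: `θ a / θ s` (`s ∉ 𝔫`) is a unit of `B(θ)` iff `a ∉ 𝔫`. -/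
theorem isUnit_mk_div_iff {a s : MvPolynomial (Option σ) K} (hs : s ∉ idealOfVars (Option σ) K) :
    IsUnit (⟨θ a / θ s, a, s, hs, rfl⟩ : frameRing θ hθ) ↔ a ∉ idealOfVars (Option σ) K := by
  constructor
  · rintro ⟨u, hu⟩ ha
    obtain ⟨a', s', hs', hinv⟩ := (mem_frameRing_iff θ hθ).mp (u⁻¹ : (frameRing θ hθ)ˣ).val.2
    have h1 : ((u : frameRing θ hθ) : L) * ((u⁻¹ : (frameRing θ hθ)ˣ) : frameRing θ hθ) = 1 := by
      rw [← Subring.coe_mul, Units.mul_inv, Subring.coe_one]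
    rw [hu, hinv] at h1
    change θ a / θ s * (θ a' / θ s') = 1 at h1
    have h2 : θ (a * a') = θ (s * s') := by
      rw [map_mul, map_mul]
      have hs0 := map_ne_zero_of_not_mem θ hθ hs
      have hs'0 := map_ne_zero_of_not_mem θ hθ hs'
      field_simp at h1
      linear_combination h1
    exact mul_not_mem_idealOfVars hs hs' (hθ h2 ▸ Ideal.mul_mem_right a' _ ha)
  · intro ha
    exact IsUnit.of_mul_eq_one ⟨θ s / θ a, s, a, ha, rfl⟩ (Subtype.ext (by
      change θ a / θ s * (θ s / θ a) = 1
      rw [div_mul_div_comm, mul_comm (θ s), div_self (mul_ne_zero (map_ne_zero_of_not_mem θ hθ ha) (map_ne_zero_of_not_mem θ hθ hs))]))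

omit [Fintype σ] [DecidableEq σ] in
/-- **`B(θ)` is local.** -/
theorem isLocalRing_frameRing : IsLocalRing (frameRing θ hθ) := by
  refine IsLocalRing.of_nonunits_add ?_
  rintro ⟨x, a, s, hs, rfl⟩ ⟨y, a', s', hs', rfl⟩ hx hy
  rw [mem_nonunits_iff, isUnit_mk_div_iff θ hθ hs, not_not] at hx
  rw [mem_nonunits_iff, isUnit_mk_div_iff θ hθ hs', not_not] at hy
  have heq : (⟨θ a / θ s, a, s, hs, rfl⟩ : frameRing θ hθ) + ⟨θ a' / θ s', a', s', hs', rfl⟩ =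
      ⟨θ (a * s' + s * a') / θ (s * s'), a * s' + s * a', s * s', mul_not_mem_idealOfVars hs hs', rfl⟩ :=
    Subtype.ext (by
      change θ a / θ s + θ a' / θ s' = θ (a * s' + s * a') / θ (s * s')
      rw [div_add_div _ _ (map_ne_zero_of_not_mem θ hθ hs) (map_ne_zero_of_not_mem θ hθ hs'), map_add, map_mul, map_mul, map_mul])
  rw [heq, mem_nonunits_iff, isUnit_mk_div_iff θ hθ (mul_not_mem_idealOfVars hs hs'), not_not]
  exact Ideal.add_mem _ (Ideal.mul_mem_right _ _ hx) (Ideal.mul_mem_left _ _ hy)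

omit [Fintype σ] [DecidableEq σ] in
/-- **The maximal ideal of `B(θ)` read in `L`**: `θ a / θ s` with `a ∈ 𝔫`, `s ∉ 𝔫`. -/
theorem mem_maxSet_frameRing_iff {x : L} :
    haveI := isLocalRing_frameRing θ hθ; x ∈ maxSet (frameRing θ hθ) ↔
      ∃ a s : MvPolynomial (Option σ) K, a ∈ idealOfVars (Option σ) K ∧ s ∉ idealOfVars (Option σ) K ∧ x = θ a / θ s := by
  haveI := isLocalRing_frameRing θ hθ
  constructor
  · rintro ⟨⟨a, s, hs, rfl⟩, hm⟩
    refine ⟨a, s, ?_, hs, rfl⟩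
    rw [mem_maximalIdeal, mem_nonunits_iff, isUnit_mk_div_iff θ hθ hs, not_not] at hm
    exact hm
  · rintro ⟨a, s, ha, hs, rfl⟩
    refine ⟨⟨a, s, hs, rfl⟩, ?_⟩
    rw [mem_maximalIdeal, mem_nonunits_iff, isUnit_mk_div_iff θ hθ hs, not_not]
    exact ha

omit [Fintype σ] [DecidableEq σ] in
/-- The codomain restriction `K[Z,u] → B(θ)` of the frame.  DEFINITION (support, data). -/
def toFrameRing : MvPolynomial (Option σ) K →+* frameRing θ hθ where
  toFun a := ⟨θ a, map_mem_frameRing θ hθ a⟩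
  map_one' := Subtype.ext (map_one θ)
  map_mul' a b := Subtype.ext (map_mul θ a b)
  map_zero' := Subtype.ext (map_zero θ)
  map_add' a b := Subtype.ext (map_add θ a b)

omit [Fintype σ] [DecidableEq σ] in
/-- The structure map into `frameRing θ hθ` on underlying elements of `L` is `θ` (definitional). -/
@[simp] theorem coe_toFrameRing (a : MvPolynomial (Option σ) K) : ((toFrameRing θ hθ a : frameRing θ hθ) : L) = θ a := rfl

omit [Fintype σ] [DecidableEq σ] in
/-- `θ(𝔫) ⊆ (θ Z, θ u)`. -/
theorem map_idealOfVars_le_originIdeal : (idealOfVars (Option σ) K).map (toFrameRing θ hθ) ≤ originIdeal θ hθ := by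
  rw [Ideal.map_le_iff_le_comap, idealOfVars, Ideal.span_le]
  rintro _ ⟨o, rfl⟩
  rw [SetLike.mem_coe, Ideal.mem_comap]
  exact Ideal.subset_span ⟨o, rfl⟩

omit [Fintype σ] [DecidableEq σ] in
/-- **The origin ideal is the maximal ideal of `B(θ)`.** -/
theorem originIdeal_eq_maximalIdeal : haveI := isLocalRing_frameRing θ hθ; originIdeal θ hθ = maximalIdeal (frameRing θ hθ) := by
  haveI := isLocalRing_frameRing θ hθ
  apply le_antisymm
  · rw [originIdeal, Ideal.span_le]
    rintro _ ⟨o, rfl⟩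
    rw [SetLike.mem_coe, mem_maximalIdeal, mem_nonunits_iff]
    change ¬IsUnit (⟨θ (X o), map_mem_frameRing θ hθ (X o)⟩ : frameRing θ hθ)
    have h := isUnit_mk_div_iff θ hθ (a := X o) (one_not_mem_idealOfVars (K := K) (τ := Option σ))
    have heq : (⟨θ (X o), map_mem_frameRing θ hθ (X o)⟩ : frameRing θ hθ) = ⟨θ (X o) / θ 1, X o, 1, one_not_mem_idealOfVars, rfl⟩ :=
      Subtype.ext (by change θ (X o) = θ (X o) / θ 1; rw [map_one, div_one])
    rw [heq, h, not_not]
    exact Ideal.subset_span ⟨o, rfl⟩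
  · rintro ⟨x, a, s, hs, rfl⟩ hm
    rw [mem_maximalIdeal, mem_nonunits_iff, isUnit_mk_div_iff θ hθ hs, not_not] at hm
    have hx : (⟨θ a / θ s, a, s, hs, rfl⟩ : frameRing θ hθ) = toFrameRing θ hθ a * ⟨θ 1 / θ s, 1, s, hs, rfl⟩ :=
      Subtype.ext (by change θ a / θ s = θ a * (θ 1 / θ s); rw [map_one, mul_one_div])
    rw [hx]
    exact Ideal.mul_mem_right _ _ (map_idealOfVars_le_originIdeal θ hθ (Ideal.mem_map_of_mem _ hm))

omit [Fintype σ] [DecidableEq σ] in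
/-- Hence membership in the origin ideal, read in `L`, is membership in `maxSet B(θ)` — the form `KCert.exists_cert_of_eq` consumes. -/
theorem mem_originIdeal_iff_mem_maxSet (x : L) :
    haveI := isLocalRing_frameRing θ hθ;
    (∃ hx : x ∈ frameRing θ hθ, (⟨x, hx⟩ : frameRing θ hθ) ∈ originIdeal θ hθ) ↔ x ∈ maxSet (frameRing θ hθ) := by
  haveI := isLocalRing_frameRing θ hθ
  rw [originIdeal_eq_maximalIdeal θ hθ]
  rfl

end Summit.ResolutionOfSingularities.ResolutionOfSingularities.Theorems.KFrameRing
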